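/- Copyright: the b2b-balaban cell (near-miss cell 7), T⁴-continuum fan-out, ROUND-2 swarm of lineage t4-ne7b-p1
(node U5c COUNT member), seat t4-ne7b-formalise-leaf-04.  Released under the licence of the surrounding project. -/
import Summits.QuantumFields.BalabanUV.T4Continuum.Support.HistoryConstantsTH

/-!
# History constants: surcharges absorbed by the birth-credit slack (sub-row S9c)

Summits-side support leaf of the T⁴-continuum cell (rung (B)+1 on a FINITE torus only; NOT infinite volume, NOT the
mass gap, NOT the Clay statement; NOT a proof of the spine estimate NE7b).  Claim table
`t4/b2b-balaban-t4-ne7b-p1/LEAVES-NE7b.md`, sub-row S9c of S9 (cell journal «CLAIM NE7b-S9c», 2026-08-20).  [folklore]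
real arithmetic and finite sums over the lineage's own carrier; nothing printed is asserted beyond the shapes LOCATED in
`HistoryConstants`; no `Prop`-valued fact of Bałaban's is minted; no constant is specialised (c1∕c2∕c6).

WHY.  The junction `Dominates C O` of row S9 compares print's per-operation entries with the model's at EQUAL shape
variables; its price side (`HistoryConstantsTH`) uses only the credits, and print's birth credit `½γ₀A₁²·p₀²·(d′+1)`
exceeds the model's `a·p₀²·(d′+1)` by the SLACK `(½γ₀A₁² − a)·p₀(g_j)²·(d′+1)` per birth.  Several items that the reading
(ID-a)∕H3 would otherwise have to DISPLAY are per-birth SURCHARGES of exactly this kind: the class-linear entropy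
`θ·(d′+1)` (resummation «exp O(1)(MR_j)^{−d}|Z_j|» p. 383; S9b's slack variant), print's BIRTH-STEP size term
«O(1)M^dR_j^{d+1}d′_j(Z)» of the first exponential of (1.79) (netted by print itself in (1.82); the dictionary books no
size at the birth step), and the multiplicity surplus `Λ′^{S}` of (2.5)-window-drop steps (row S6f, ruling R-OWNER-22-2
(U2): `S ≤ s_{rootStep}`, `R_j = L^{s_j}`), charged on the root birth.  This leaf books them ONCE, generically.

WHAT.  §1 `slackT O C g e` (the slack of a dictionary event: `(½γ₀A₁² − a)·p₀(g_j)²·(d′+1)` at a birth, `0` else),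
`pcredit_eq_credit_add_slack`, `creditsT_eq_add_slack`, **`creditsT_surcharge_le`**: ANY per-label surcharge `σ` with
`σ e ≤ slackT O C g (sh e)` at every event satisfies `credits (credit C g ∘ sh) G + Σ_{events} σ ≤ credits (pcredit O C g ∘
sh) G`; **`pshapeTH_mul_exp_surcharge_le_shapeTH`** and the product form **`le_prod_shapeTH_surcharge`** (the TH exit's
shape absorbs `e^{Σσ}`).  §2 INSTANCES, each with its γ-clause DISPLAYED per step in the family of the exit's thresholds:
(a) `linear_le_slackT` — `θ·(d′+1)` under `C.a + θ ≤ ½γ₀A₁²`, profile `≥ 1` (S9b recovered); (b) **`birthStep_le_slackT`**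
— print's birth-step term `o80·M^d·R_j^{d+1}·d′` under `hγb : o80·M^d·R_j^{d+1} ≤ (½γ₀A₁² − a)·p₀(g_j)²`, and
**`birthStepClause_of_threshold`** — `hγb` DERIVED at every step from (2.5) (`B14.IsRj`, via
`B14FlowStep.isRj_le_mul_logpow`), `1 ≤ log g⁻²`, the exponent room `r·(d+1) + 1 ≤ 2p₀` (implied by R9 `r·(d+2) < p₀`)
and ONE symbolic threshold `birthStepThreshold O C L ≤ log g_j⁻²`; (c) **`root_surcharge_le`** — a factor `Λ′^S` charged
on the root birth is absorbed when `S·log Λ′ ≤ slackT O C g (sh root)` (the slot S6f's absorption plugs into).  §3 sanity.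

HONEST.  The surcharges still have to be IDENTIFIED with print's realised factors by the reading H3 (displayed by the
consumer); what leaves the displayed residue is the ARITHMETIC of their absorption and its threshold.  Slack is ONE
budget: a consumer absorbing several surcharges sums them into one `σ` (the lemmas are stated for arbitrary `σ`).
Discharges nothing of (B) ∕ BetaPertH.  NE7b NOT proved; spine 0∕9.  HONEST DEPENDENCY (cell): continuum YM on T⁴ ⇐
BetaPertH ∧ nine spine estimates (0/9 proved); BetaPertH ⇐ (D1) ∧ (D4) ∧ CAP+tail; G-an2-4 gates asym, D1 and NE2/3/4.
-/

open Finset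
open Literature.MathematicalPhysics.QuantumFieldTheory.Balaban1983to89
open T4PersistenceDictionary T4PersistentHistoryCount T4BankedInduction T4PrintedShapeBanking T4PartnerMultiplicity
open T4TaggedShapeBanking
open Summit.QuantumFields.BalabanUV.T4Continuum.LateMergers

namespace Summit.QuantumFields.BalabanUV.T4Continuum.HistoryConstants

noncomputable section

/-! ## §1 The birth-credit slack and generic surcharge absorption -/

section Generic

variable {ε : Type*} [DecidableEq ε] {C : T4PrintedShapeBanking.Consts} {O : PrintedO1s}

/-- **THE BIRTH-CREDIT SLACK** of a dictionary event at couplings `g`: `(½γ₀A₁² − a)·p₀(g_j)²·(d′+1)` at a birth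
`(j, 0, d′)`, `0` at renewals and mergers (print's and the model's entries coincide there). [folklore] -/
def slackT (O : PrintedO1s) (C : T4PrintedShapeBanking.Consts) (g : ℕ → ℝ) (e : PEv) : ℝ :=
  if e.kind = 0 then (O.γ₀ * O.A₁ ^ 2 / 2 - C.a) * p0Profile C.A₀ C.p₀ (g e.step) ^ 2 * ((e.fat : ℝ) + 1) else 0

/-- slack of a birth [folklore] -/
theorem slackT_kind0 {g : ℕ → ℝ} {e : PEv} (h : e.kind = 0) :
    slackT O C g e = (O.γ₀ * O.A₁ ^ 2 / 2 - C.a) * p0Profile C.A₀ C.p₀ (g e.step) ^ 2 * ((e.fat : ℝ) + 1) := by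
  simp [slackT, h]

/-- no slack off births [folklore] -/
theorem slackT_of_ne {g : ℕ → ℝ} {e : PEv} (h : e.kind ≠ 0) : slackT O C g e = 0 := by simp [slackT, h]

/-- the slack is nonnegative under the junction's birth inequality `a ≤ ½γ₀A₁²` [folklore] -/
theorem slackT_nonneg (hb : C.a ≤ O.γ₀ * O.A₁ ^ 2 / 2) (g : ℕ → ℝ) (e : PEv) : 0 ≤ slackT O C g e := by
  unfold slackT; split_ifs
  · have : 0 ≤ O.γ₀ * O.A₁ ^ 2 / 2 - C.a := by linarith
    positivity
  · exact le_rfl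

/-- **PRINT'S CREDIT = THE MODEL'S CREDIT + THE SLACK**, event by event. [folklore] -/
theorem pcredit_eq_credit_add_slack (g : ℕ → ℝ) (e : PEv) : pcredit O C g e = credit C g e + slackT O C g e := by
  by_cases h0 : e.kind = 0
  · rw [pcredit_kind0 h0, credit_kind0 h0, slackT_kind0 h0]; ring
  · rw [slackT_of_ne h0, add_zero]
    by_cases h1 : e.kind = 1
    · rw [pcredit_kind1 h1, credit_kind1 h1]
    · have h2 : e.kind = 2 := by
        generalize hk : e.kind = k at h0 h1 ⊢
        fin_cases k <;> simp_all
      rw [pcredit_kind2 h2, credit_kind2 h2]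

variable (sh : ε → PEv)

/-- … hence for a tagged genealogy `credits (pcredit ∘ sh) = credits (credit ∘ sh) + Σ slack`. [folklore] -/
theorem creditsT_eq_add_slack (g : ℕ → ℝ) (G : Gen ε) :
    credits (pcredit O C g ∘ sh) G = credits (credit C g ∘ sh) G + ∑ e ∈ G.events, slackT O C g (sh e) := by
  unfold credits
  rw [← sum_add_distrib]
  exact sum_congr rfl fun e _ => pcredit_eq_credit_add_slack g (sh e)

/-- **GENERIC SURCHARGE ABSORPTION**: any per-label surcharge bounded by the slack at every event of the genealogy is
paid by print's credits on top of the model's. [folklore] -/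
theorem creditsT_surcharge_le (g : ℕ → ℝ) {G : Gen ε} (σ : ε → ℝ)
    (hσ : ∀ e ∈ G.events, σ e ≤ slackT O C g (sh e)) :
    credits (credit C g ∘ sh) G + ∑ e ∈ G.events, σ e ≤ credits (pcredit O C g ∘ sh) G := by
  rw [creditsT_eq_add_slack sh g G]
  exact add_le_add le_rfl (sum_le_sum hσ)

/-- **THE TH SHAPE ABSORBS `e^{Σσ}`**: print-priced TH shape (realised cost read below `costT` on the padded life) times
the exponential of an absorbed surcharge is below the TH exit's shape. [folklore] -/
theorem pshapeTH_mul_exp_surcharge_le_shapeTH {Δ Λ' : ℝ} (hΔ : 0 ≤ Δ) (hΛ : 0 ≤ Λ') (R : ℕ → ℕ) (g : ℕ → ℝ)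
    (K D : ℕ) {κ : Gen ε → ℕ → ℝ} {G : Gen ε} (σ : ε → ℝ) (hσ : ∀ e ∈ G.events, σ e ≤ slackT O C g (sh e))
    (h : ∀ n ∈ life (padW (dictWT sh R C.n₁) D) G, κ G n ≤ costT sh C K R G n) :
    pshapeTH sh O C Δ Λ' R g D κ G * Real.exp (∑ e ∈ G.events, σ e) ≤ shapeTH sh C Δ Λ' R g K D G := by
  unfold pshapeTH shapeTH
  have hc : Real.exp (-credits (pcredit O C g ∘ sh) G) * Real.exp (∑ e ∈ G.events, σ e) ≤
      Real.exp (-credits (credit C g ∘ sh) G) := by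
    rw [← Real.exp_add]
    exact Real.exp_le_exp.2 (by linarith [creditsT_surcharge_le sh g σ hσ])
  have hl : Real.exp (lifeCost (padW (dictWT sh R C.n₁) D) κ G) ≤
      Real.exp (lifeCost (padW (dictWT sh R C.n₁) D) (costT sh C K R) G) :=
    Real.exp_le_exp.2 (lifeCostT_mono h)
  have hraw : Real.exp (-credits (pcredit O C g ∘ sh) G) * Real.exp (lifeCost (padW (dictWT sh R C.n₁) D) κ G) *
      Real.exp (∑ e ∈ G.events, σ e) ≤ Real.exp (-credits (credit C g ∘ sh) G) *
        Real.exp (lifeCost (padW (dictWT sh R C.n₁) D) (costT sh C K R) G) := by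
    calc _ = Real.exp (-credits (pcredit O C g ∘ sh) G) * Real.exp (∑ e ∈ G.events, σ e) *
          Real.exp (lifeCost (padW (dictWT sh R C.n₁) D) κ G) := by ring
      _ ≤ _ := mul_le_mul hc hl (Real.exp_pos _).le (Real.exp_pos _).le
  have hpre : 0 ≤ Δ * Λ' ^ partnerAges (PEv.step ∘ sh) G := mul_nonneg hΔ (pow_nonneg hΛ _)
  calc _ = Δ * Λ' ^ partnerAges (PEv.step ∘ sh) G * (Real.exp (-credits (pcredit O C g ∘ sh) G) *
        Real.exp (lifeCost (padW (dictWT sh R C.n₁) D) κ G) * Real.exp (∑ e ∈ G.events, σ e)) := by ring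
    _ ≤ Δ * Λ' ^ partnerAges (PEv.step ∘ sh) G * (Real.exp (-credits (credit C g ∘ sh) G) *
        Real.exp (lifeCost (padW (dictWT sh R C.n₁) D) (costT sh C K R) G)) :=
      mul_le_mul_of_nonneg_left hraw hpre
    _ = _ := by ring

/-- **THE PRODUCT STEP WITH SURCHARGES**: over any finite family of live structures with per-member surcharges `σ q`
absorbed by the members' slacks. [folklore] -/
theorem le_prod_shapeTH_surcharge {Δ Λ' : ℝ} (hΔ : 0 ≤ Δ) (hΛ : 0 ≤ Λ') (R : ℕ → ℕ) (g : ℕ → ℝ) (K D : ℕ)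
    {ι : Type*} (S : Finset ι) (gen : ι → Gen ε) {mult : ι → ℝ} (hmult : ∀ q ∈ S, 0 ≤ mult q)
    (κ : ι → Gen ε → ℕ → ℝ) (σ : ι → ε → ℝ)
    (hσ : ∀ q ∈ S, ∀ e ∈ (gen q).events, σ q e ≤ slackT O C g (sh e))
    (h : ∀ q ∈ S, ∀ n ∈ life (padW (dictWT sh R C.n₁) D) (gen q), κ q (gen q) n ≤ costT sh C K R (gen q) n)
    {x : ℝ} (hx : x ≤ ∏ q ∈ S, mult q * (pshapeTH sh O C Δ Λ' R g D (κ q) (gen q) *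
      Real.exp (∑ e ∈ (gen q).events, σ q e))) :
    x ≤ ∏ q ∈ S, mult q * shapeTH sh C Δ Λ' R g K D (gen q) :=
  hx.trans (prod_le_prod
    (fun q hq => mul_nonneg (hmult q hq) (mul_nonneg (pshapeTH_nonneg sh hΔ hΛ R g D _ _) (Real.exp_pos _).le))
    fun q hq => mul_le_mul_of_nonneg_left
      (pshapeTH_mul_exp_surcharge_le_shapeTH sh hΔ hΛ R g K D (σ q) (hσ q hq) (h q hq)) (hmult q hq))

end Generic

/-! ## §2 Instances with displayed γ-clauses -/

section Instances

variable {C : T4PrintedShapeBanking.Consts} {O : PrintedO1s}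

/-- (a) **CLASS-LINEAR ENTROPY** `θ·(d′+1)` is below the slack under `C.a + θ ≤ ½γ₀A₁²`, `θ ≥ 0` and profile `≥ 1` at the
birth step (S9b's `creditsT_slack` recovered as an instance). [folklore] -/
theorem linear_le_slackT {θ : ℝ} (hθ : 0 ≤ θ) (hslack : C.a + θ ≤ O.γ₀ * O.A₁ ^ 2 / 2) {g : ℕ → ℝ} {e : PEv}
    (h0 : e.kind = 0) (hP : 1 ≤ p0Profile C.A₀ C.p₀ (g e.step)) :
    θ * ((e.fat : ℝ) + 1) ≤ slackT O C g e := by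
  rw [slackT_kind0 h0]
  have hsq : 1 ≤ p0Profile C.A₀ C.p₀ (g e.step) ^ 2 := by nlinarith
  have hf : (0 : ℝ) ≤ (e.fat : ℝ) + 1 := by positivity
  have h1 : θ ≤ (O.γ₀ * O.A₁ ^ 2 / 2 - C.a) * p0Profile C.A₀ C.p₀ (g e.step) ^ 2 := by
    have := mul_le_mul_of_nonneg_left hsq hθ
    nlinarith [this]
  exact mul_le_mul_of_nonneg_right h1 hf

/-- **PRINT'S BIRTH-STEP SIZE TERM** of a new region of class `d′` at step `j`: «O(1)M^dR_j^{d+1}d′_j(Z)» (the step-`j`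
summand of the first exponential of (1.79) p. 383 for that region; netted by print in (1.82)) — `o80·M^d·ρ^{d+1}·d′`,
`ρ = R_j`. [folklore] -/
def PrintedO1s.birthStep (O : PrintedO1s) (ρ d' : ℝ) : ℝ := O.o80 * O.M ^ O.d * ρ ^ (O.d + 1) * d'

/-- (b) **THE BIRTH-STEP TERM IS BELOW THE SLACK** under the displayed per-step γ-clause
`hγb : o80·M^d·R_j^{d+1} ≤ (½γ₀A₁² − a)·p₀(g_j)²`. [folklore] -/
theorem birthStep_le_slackT (hO : O.Pos) {R : ℕ → ℕ} {g : ℕ → ℝ} {e : PEv} (h0 : e.kind = 0)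
    (hγb : O.o80 * O.M ^ O.d * (R e.step : ℝ) ^ (O.d + 1) ≤
      (O.γ₀ * O.A₁ ^ 2 / 2 - C.a) * p0Profile C.A₀ C.p₀ (g e.step) ^ 2) :
    O.birthStep (R e.step) e.fat ≤ slackT O C g e := by
  rw [slackT_kind0 h0, PrintedO1s.birthStep]
  have hB : 0 ≤ O.o80 * O.M ^ O.d * (R e.step : ℝ) ^ (O.d + 1) := by
    have := hO.o80_pos; have := hO.M_pos; positivity
  have hf : (e.fat : ℝ) ≤ (e.fat : ℝ) + 1 := by linarith
  calc O.o80 * O.M ^ O.d * (R e.step : ℝ) ^ (O.d + 1) * (e.fat : ℝ)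
      ≤ O.o80 * O.M ^ O.d * (R e.step : ℝ) ^ (O.d + 1) * ((e.fat : ℝ) + 1) :=
        mul_le_mul_of_nonneg_left hf hB
    _ ≤ (O.γ₀ * O.A₁ ^ 2 / 2 - C.a) * p0Profile C.A₀ C.p₀ (g e.step) ^ 2 * ((e.fat : ℝ) + 1) :=
        mul_le_mul_of_nonneg_right hγb (by positivity)

/-- **THE BIRTH-STEP THRESHOLD** (symbolic): `max 1 (o80·M^d·L^{d+1} ∕ ((½γ₀A₁² − a)·A₀²))`. [folklore] -/
def birthStepThreshold (O : PrintedO1s) (C : T4PrintedShapeBanking.Consts) (L : ℕ) : ℝ :=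
  max 1 (O.o80 * O.M ^ O.d * (L : ℝ) ^ (O.d + 1) / ((O.γ₀ * O.A₁ ^ 2 / 2 - C.a) * C.A₀ ^ 2))

/-- **THE γ-CLAUSE OF (b) FROM (2.5) AND ONE INFRARED THRESHOLD**: along a step whose window obeys (2.5)
(`B14.IsRj L r (g s) (R s)`), with `1 ≤ log g_s⁻²`, STRICT slack `a < ½γ₀A₁²`, `0 < A₀`, exponent room `r·(d+1) + 1 ≤ 2p₀`
(implied by the cell's (X7) ∕ print's R9 `r·(d+2) < p₀`) and `birthStepThreshold O C L ≤ log g_s⁻²`: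
`o80·M^d·R_s^{d+1} ≤ (½γ₀A₁² − a)·p₀(g_s)²`. [folklore] -/
theorem birthStepClause_of_threshold (hO : O.Pos) {L r : ℕ} (hL : 1 ≤ L) (hslack : C.a < O.γ₀ * O.A₁ ^ 2 / 2)
    (hA : 0 < C.A₀) (hexp : r * (O.d + 1) + 1 ≤ 2 * C.p₀) {R : ℕ → ℕ} {g : ℕ → ℝ} {s : ℕ}
    (hR : B14.IsRj L r (g s) (R s)) (hx1 : 1 ≤ Real.log ((g s) ^ 2)⁻¹)
    (hthr : birthStepThreshold O C L ≤ Real.log ((g s) ^ 2)⁻¹) :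
    O.o80 * O.M ^ O.d * (R s : ℝ) ^ (O.d + 1) ≤ (O.γ₀ * O.A₁ ^ 2 / 2 - C.a) * p0Profile C.A₀ C.p₀ (g s) ^ 2 := by
  set x := Real.log ((g s) ^ 2)⁻¹ with hxdef
  have hx0 : 0 ≤ x := zero_le_one.trans hx1
  have hcA : 0 < (O.γ₀ * O.A₁ ^ 2 / 2 - C.a) * C.A₀ ^ 2 := mul_pos (by linarith) (by positivity)
  have hB : 0 ≤ O.o80 * O.M ^ O.d * (L : ℝ) ^ (O.d + 1) := by
    have := hO.o80_pos; have := hO.M_pos; positivity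
  -- (2.5): `R_s ≤ L·x^r`, hence `R_s^{d+1} ≤ L^{d+1}·x^{r(d+1)}`
  have hRle : (R s : ℝ) ≤ L * x ^ r := B14FlowStep.isRj_le_mul_logpow hL hR (one_le_pow₀ hx1)
  have hRpow : (R s : ℝ) ^ (O.d + 1) ≤ (L : ℝ) ^ (O.d + 1) * x ^ (r * (O.d + 1)) := by
    rw [pow_mul, ← mul_pow]
    exact pow_le_pow_left₀ (Nat.cast_nonneg _) hRle _
  -- the threshold: `o80·M^d·L^{d+1} ≤ (½γ₀A₁² − a)·A₀²·x^{2p₀ − r(d+1)}`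
  have hn : 1 ≤ 2 * C.p₀ - r * (O.d + 1) := by omega
  have hγ := gammaClause_of_large (B := O.o80 * O.M ^ O.d * (L : ℝ) ^ (O.d + 1)) hcA hn
    (by simpa [birthStepThreshold] using hthr)
  -- multiply by `x^{r(d+1)}` and reassemble `p₀(g_s)² = A₀²·x^{2p₀}`
  have hsplit : x ^ (2 * C.p₀) = x ^ (2 * C.p₀ - r * (O.d + 1)) * x ^ (r * (O.d + 1)) := by
    rw [← pow_add]; congr 1; omega
  have hP2 : p0Profile C.A₀ C.p₀ (g s) ^ 2 = C.A₀ ^ 2 * x ^ (2 * C.p₀) := by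
    rw [p0Profile, ← hxdef, mul_pow, ← pow_mul, Nat.mul_comm]
  calc O.o80 * O.M ^ O.d * (R s : ℝ) ^ (O.d + 1)
      ≤ O.o80 * O.M ^ O.d * ((L : ℝ) ^ (O.d + 1) * x ^ (r * (O.d + 1))) :=
        mul_le_mul_of_nonneg_left hRpow (by have := hO.o80_pos; have := hO.M_pos; positivity)
    _ = O.o80 * O.M ^ O.d * (L : ℝ) ^ (O.d + 1) * x ^ (r * (O.d + 1)) := by ring
    _ ≤ (O.γ₀ * O.A₁ ^ 2 / 2 - C.a) * C.A₀ ^ 2 * x ^ (2 * C.p₀ - r * (O.d + 1)) * x ^ (r * (O.d + 1)) :=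
        mul_le_mul_of_nonneg_right hγ (pow_nonneg hx0 _)
    _ = (O.γ₀ * O.A₁ ^ 2 / 2 - C.a) * p0Profile C.A₀ C.p₀ (g s) ^ 2 := by rw [hP2, hsplit]; ring

variable {ε : Type*} [DecidableEq ε] (sh : ε → PEv)

/-- (c) **A ROOT SURCHARGE `Λ′^S` IS ABSORBED** when `S·log Λ′ ≤ slackT O C g (sh root)` (`Λ′ > 0`; the slot row S6f's
window-drop surplus plugs into: `S ≤ s_{rootStep}` by (2.5), and `s_j·log Λ′` is below the root's slack above a
threshold). [folklore] -/
theorem root_surcharge_le {Δ Λ' : ℝ} (hΔ : 0 ≤ Δ) (hΛ : 0 < Λ') (R : ℕ → ℕ) (g : ℕ → ℝ) (K D : ℕ)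
    {κ : Gen ε → ℕ → ℝ} {G : Gen ε} (hb : C.a ≤ O.γ₀ * O.A₁ ^ 2 / 2) (S : ℕ)
    (hS : (S : ℝ) * Real.log Λ' ≤ slackT O C g (sh G.root))
    (h : ∀ n ∈ life (padW (dictWT sh R C.n₁) D) G, κ G n ≤ costT sh C K R G n) :
    pshapeTH sh O C Δ Λ' R g D κ G * Λ' ^ S ≤ shapeTH sh C Δ Λ' R g K D G := by
  classical
  have hexp : Λ' ^ S = Real.exp (∑ e ∈ G.events, if e = G.root then (S : ℝ) * Real.log Λ' else 0) := by
    rw [sum_ite_eq' G.events G.root, if_pos G.root_mem, Real.exp_nat_mul, Real.exp_log hΛ]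
  rw [hexp]
  refine pshapeTH_mul_exp_surcharge_le_shapeTH sh hΔ hΛ.le R g K D _ (fun e _ => ?_) h
  split_ifs with he
  · rw [he]; exact hS
  · exact slackT_nonneg hb g (sh e)

end Instances

/-! ## §3 Sanity -/

namespace Sanity

/-- the toy junction of `HistoryConstants` has birth constant `a = 1 = ½γ₀A₁²`: zero slack, so only the zero surcharge is
absorbed — the generic lemma at `σ = 0` is the plain S9b domination (decided instance on `Gt`). [folklore] -/
example : pshapeTH Prod.fst O₁ C₁ 1 2 (fun _ => 2) (fun _ => 1 / 2) 0 (costT Prod.fst C₁ 3 fun _ => 2) Gt *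
    Real.exp (∑ e ∈ Gt.events, (fun _ => (0 : ℝ)) e) ≤
      shapeTH Prod.fst C₁ 1 2 (fun _ => 2) (fun _ => 1 / 2) 3 0 Gt :=
  pshapeTH_mul_exp_surcharge_le_shapeTH Prod.fst zero_le_one zero_le_two _ _ 3 0 (fun _ => 0)
    (fun e _ => slackT_nonneg (by norm_num [C₁, O₁]) _ _) fun _ _ => le_rfl

/-- a print record with STRICT slack: `γ₀ = 4` (so `½γ₀A₁² = 2 > a = 1`); the birth-step threshold at `L = 2` is
`max 1 (1·1·2² ∕ ((2 − 1)·1)) = 4`. [folklore] -/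
def O₂ : PrintedO1s := ⟨1, 1, 4, 1, 0, 1, 1, 1, 1⟩

/-- its threshold value, decided [folklore] -/
example : birthStepThreshold O₂ C₁ 2 = 4 := by norm_num [birthStepThreshold, O₂, C₁]

end Sanity

end

end Summit.QuantumFields.BalabanUV.T4Continuum.HistoryConstants
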